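import Mathlib

/-!
# Solo-blind seat (MatrixMultiplication), s71 — the Chain Lemma, realisability direction (paper/KraftK3.md §7.12, K3.12.14)

Converse companions of `rhombus_relation` / `chain3_relation` (`SoloBlindLineIdentity`): over `𝔽₃`, if the values `q_i = Q d_i` of a
quadratic map satisfy the rhombus relation `q₁ = q₂`, the 3-chain relation `q₁ + q₃ = q₂` or the 4-chain relation `q₁ + q₃ = q₂ + q₄`,
then for the explicit linear parts `ℓ` below the supports of the rhombus `{±d₁, ±d₂}`, of the 3-chain `{±d₁, −d₂, d₂ ± d₃}` and of the
4-chain `{±d₁, −d₂, d₂ − d₃, d₂ + d₃ ± d₄}` lie in ONE level set of `F = Q + ℓ` (namely `F = q₁`).  Together with the plane enumeration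
`relationPlane_contains_chainType` (`SoloBlindRelationPlanes`) this is the algebra of THEOREM U(4,2) (no universal frame for rank-2
anisotropic systems on `𝔽₃⁴`); the existence of a linear `ℓ` with the prescribed values on independent `d_i` is standard and not repeated
here.  Pure algebra over `ZMod 3`; no `ω` content.
-/

set_option linter.dupNamespace false
set_option autoImplicit false

namespace Summit.MatrixMultiplication.MatrixMultiplication.Theorems

variable {M N : Type*} [AddCommGroup M] [Module (ZMod 3) M] [AddCommGroup N] [Module (ZMod 3) N]

/-- `3 • z = 0` in a `ZMod 3`-module, scalar form. -/
theorem three_smul_eq_zero_zmod3 (z : N) : (3 : ZMod 3) • z = 0 := by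
  rw [show (3 : ZMod 3) = 0 by decide, zero_smul]

/-- RHOMBUS, realisability: if `Q d₁ = Q d₂` and `ℓ` vanishes on `d₁, d₂`, the four points `±d₁, ±d₂` lie in `{Q + ℓ = Q d₁}`. -/
theorem rhombus_realise (Q : QuadraticMap (ZMod 3) M N) (ℓ : M →ₗ[ZMod 3] N) (d₁ d₂ : M)
    (h1 : ℓ d₁ = 0) (h2 : ℓ d₂ = 0) (hrel : Q d₁ = Q d₂) :
    Q d₁ + ℓ d₁ = Q d₁ ∧ Q (-d₁) + ℓ (-d₁) = Q d₁ ∧ Q d₂ + ℓ d₂ = Q d₁ ∧ Q (-d₂) + ℓ (-d₂) = Q d₁ := by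
  refine ⟨?_, ?_, ?_, ?_⟩ <;> simp [QuadraticMap.map_neg, map_neg, h1, h2, hrel]

/-- 3-CHAIN, realisability: with `ℓ d₁ = 0`, `ℓ d₂ = Q d₂ - Q d₁`, `ℓ d₃ = - polar Q d₂ d₃` and the relation `Q d₁ + Q d₃ = Q d₂`, the
five support points `±d₁, -d₂, d₂ ± d₃` of the 3-chain (junctions `0` and `d₂`) all lie in `{Q + ℓ = Q d₁}`. -/
theorem chain3_realise (Q : QuadraticMap (ZMod 3) M N) (ℓ : M →ₗ[ZMod 3] N) (d₁ d₂ d₃ : M)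
    (h1 : ℓ d₁ = 0) (h2 : ℓ d₂ = Q d₂ - Q d₁) (h3 : ℓ d₃ = -QuadraticMap.polar Q d₂ d₃)
    (hrel : Q d₁ + Q d₃ = Q d₂) :
    Q d₁ + ℓ d₁ = Q d₁ ∧ Q (-d₁) + ℓ (-d₁) = Q d₁ ∧ Q (-d₂) + ℓ (-d₂) = Q d₁ ∧
      Q (d₂ + d₃) + ℓ (d₂ + d₃) = Q d₁ ∧ Q (d₂ - d₃) + ℓ (d₂ - d₃) = Q d₁ := by
  have e3 := three_smul_eq_zero_zmod3 (Q d₂)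
  refine ⟨?_, ?_, ?_, ?_, ?_⟩
  · rw [h1, add_zero]
  · rw [QuadraticMap.map_neg, map_neg, h1, neg_zero, add_zero]
  · rw [QuadraticMap.map_neg, map_neg, h2]; abel
  · rw [QuadraticMap.map_add Q d₂ d₃, map_add, h2, h3]
    -- Q d₂ + Q d₃ + polar + (Q d₂ - Q d₁ + -polar) = Q d₁
    rw [← hrel] at e3 ⊢
    -- rewrite hrel: Q d₂ = Q d₁ + Q d₃
    linear_combination (norm := skip) e3
    match_scalars <;> decide
  · rw [sub_eq_add_neg d₂ d₃, QuadraticMap.map_add Q d₂ (-d₃), QuadraticMap.map_neg, QuadraticMap.polar_neg_right, map_add, map_neg, h2, h3]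
    rw [← hrel] at e3 ⊢
    linear_combination (norm := skip) e3
    match_scalars <;> decide

/-- 4-CHAIN, realisability: with `ℓ d₁ = 0`, `ℓ d₂ = Q d₂ - Q d₁`, `ℓ d₃ = Q d₁ - Q d₂ + Q d₃ - polar Q d₂ d₃`,
`ℓ d₄ = - polar Q (d₂ + d₃) d₄` and the relation `Q d₁ + Q d₃ = Q d₂ + Q d₄`, the six support points `±d₁, -d₂, d₂ - d₃, d₂ + d₃ ± d₄`
of the 4-chain (junctions `0`, `d₂`, `d₂ + d₃`) all lie in `{Q + ℓ = Q d₁}`. -/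
theorem chain4_realise (Q : QuadraticMap (ZMod 3) M N) (ℓ : M →ₗ[ZMod 3] N) (d₁ d₂ d₃ d₄ : M)
    (h1 : ℓ d₁ = 0) (h2 : ℓ d₂ = Q d₂ - Q d₁) (h3 : ℓ d₃ = Q d₁ - Q d₂ + Q d₃ - QuadraticMap.polar Q d₂ d₃)
    (h4 : ℓ d₄ = -QuadraticMap.polar Q (d₂ + d₃) d₄) (hrel : Q d₁ + Q d₃ = Q d₂ + Q d₄) :
    Q d₁ + ℓ d₁ = Q d₁ ∧ Q (-d₁) + ℓ (-d₁) = Q d₁ ∧ Q (-d₂) + ℓ (-d₂) = Q d₁ ∧ Q (d₂ - d₃) + ℓ (d₂ - d₃) = Q d₁ ∧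
      Q (d₂ + d₃ + d₄) + ℓ (d₂ + d₃ + d₄) = Q d₁ ∧ Q (d₂ + d₃ - d₄) + ℓ (d₂ + d₃ - d₄) = Q d₁ := by
  have e2 := three_smul_eq_zero_zmod3 (Q d₂)
  have e3 := three_smul_eq_zero_zmod3 (Q d₃)
  refine ⟨?_, ?_, ?_, ?_, ?_, ?_⟩
  · rw [h1, add_zero]
  · rw [QuadraticMap.map_neg, map_neg, h1, neg_zero, add_zero]
  · rw [QuadraticMap.map_neg, map_neg, h2]; abel
  · rw [sub_eq_add_neg d₂ d₃, QuadraticMap.map_add Q d₂ (-d₃), QuadraticMap.map_neg, QuadraticMap.polar_neg_right, map_add, map_neg, h2, h3]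
    linear_combination (norm := skip) e2
    match_scalars <;> decide
  · rw [QuadraticMap.map_add Q (d₂ + d₃) d₄, QuadraticMap.map_add Q d₂ d₃, map_add, map_add, h2, h3, h4]
    -- uses hrel: Q d₄ = Q d₁ + Q d₃ - Q d₂
    have h4' : Q d₄ = Q d₁ + Q d₃ - Q d₂ := by rw [hrel]; abel
    rw [h4']
    linear_combination (norm := skip) e3
    match_scalars <;> decide
  · rw [sub_eq_add_neg (d₂ + d₃) d₄, QuadraticMap.map_add Q (d₂ + d₃) (-d₄), QuadraticMap.map_neg, QuadraticMap.polar_neg_right,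
      QuadraticMap.map_add Q d₂ d₃, map_add, map_add, map_neg, h2, h3, h4]
    have h4' : Q d₄ = Q d₁ + Q d₃ - Q d₂ := by rw [hrel]; abel
    rw [h4']
    linear_combination (norm := skip) e3
    match_scalars <;> decide

end Summit.MatrixMultiplication.MatrixMultiplication.Theorems
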